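import Mathlib
import HarnessLib
import Summits.HubbardSuperconductivity.HubbardSuperconductivity.Theorems.KLProgrammeKLRegimeEngineTowerBlockIncrWtPowFull
import Summits.HubbardSuperconductivity.HubbardSuperconductivity.Theorems.KLProgrammeKLRegimeEngineTowerBlockStepWtFullSubTadpole

/-!
# Route `KLProgramme` — crux K3 ENGINE (stmt-HubbardSuperconductivity-20437 `KLRegimeEngineV17F2`), stub (b) / E1 interface (E2) in-tower route, located item
# «(E2)-ROUTE-TADPOLE»: THE DEGREE-`Dw` WEIGHTED BORN SIZES OF A BLOCK INCREMENT WITHOUT ITS BLOCK TADPOLE — `Δ_k − Δ_Γ 𝒱_{dk}`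
# (recipe «(E2)-POW3-TRACK» option (i), layer 4 = pieces 2–3 of the three-piece split; cell gate-hubbard-kl, seat hubbard-kl-k3c3-p2 g19)

`Δ_k = klTowerIncr … d k = (effAction Γ 𝒱_{dk} − e^{Δ_Γ}𝒱_{dk}) + (e^{Δ_Γ}𝒱_{dk} − 𝒱_{dk})` (`klTowerIncr_eq_ordersGe2_add_firstOrder`, `Γ = C^K_{(Λ_{d(k+1)},Λ_{dk}]}`), so
`Δ_k − Δ_Γ 𝒱_{dk} = (effAction Γ 𝒱_{dk} − e^{Δ_Γ}𝒱_{dk}) + (e^{Δ_Γ}𝒱_{dk} − 𝒱_{dk} − Δ_Γ 𝒱_{dk})` = at least two vertices + at least two self-lines: the born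
increment with the block TADPOLE removed (the one-line contraction of the input; for the two-leg output it is the tadpole of the quartic kernel of `𝒱_{dk}`, linear in
it, whose bare-`U` part is exactly local and belongs to the dispersion lane's local parts).  Exactly as `…TowerBlockIncrWtPowFull` for the full increment:

* §1 **`pinnedTupleWtPowSum_klTowerIncr_subTadpole_le`** — the `klScaleWtPow … J′ Dw`-weighted single-tuple pinned sums of `Δ_k − Δ_Γ 𝒱_{dk}` at `F_{J′}` (`J′ ≥ dk`)
  in every even degree `2(q+1)` (two legs: `q = 0`), every pinned leg/label tuple/pin, `≤ ε^{2q+1}·(graded-prescribed RHS + binomial-prescribed RHS over m′ > q+2)` —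
  the graded door `blockStep_ordersGe2_wtFull_le` + the sub-tadpole door `blockStep_geTwoLines_wtFull_le`;
* §2 **`pinnedTupleWtPowSum_klTowerIncr_subTadpole_le_pinFree`** — at the born family `J′ = dk`, right side pin-free (def-free).
For two legs (`q = 0`) the binomial part starts at input degree `2m′ ≥ 6`: NO quartic-tadpole term.  Compositions of landed theorems; the block constants are HYPOTHESES;
nothing asserts (E2), any stub, K3 or superconductivity.
References: BGM 2006 §2.7 (2.70)–(2.71a), §2.8 (2.76)–(2.84), (2.86)–(2.90), §3 (3.5)–(3.6) [cite: BenfattoGiulianiMastropietro2006].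
-/

noncomputable section

namespace Summit.HubbardSuperconductivity.HubbardSuperconductivity.Theorems.EngineV8

set_option linter.dupNamespace false -- summit = problem name (single-conjunct summit), D-0017

open Classical
open Real Finset Literature.MathematicalPhysics.QuantumLattice Literature.Probability.LatticeModels GrassmannAlgebra
open Summit.HubbardSuperconductivity.HubbardSuperconductivity.Theorems.KLProgrammeLegKernels
open Summit.HubbardSuperconductivity.HubbardSuperconductivity.Theorems.KLRegimeSplit
open Summit.HubbardSuperconductivity.HubbardSuperconductivity.Theorems.KLRegimeWick
open Summit.HubbardSuperconductivity.HubbardSuperconductivity.Theorems.TwoPointAssembly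
open Literature.Probability.LatticeModels.BattleFederbush

section Born

variable {L M : ℕ} [NeZero L] [NeZero M]

/-! ## §1 The single-tuple degree-`Dw` weighted pinned sums of `Δ_k − Δ_Γ 𝒱_{dk}` -/

/-- **THE DEGREE-`Dw` WEIGHTED SIZES OF A BLOCK INCREMENT WITHOUT ITS BLOCK TADPOLE.**  Binders of `pinnedTupleWtPowSum_klTowerIncr_le` verbatim; conclusion for
`Δ_k − Δ_Γ 𝒱_{dk}` with the binomial-prescribed sum over `m′ > q + 2`. [cite: BenfattoGiulianiMastropietro2006, (2.70)-(2.71a), (2.86)-(2.90), (3.5)-(3.6)] -/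
theorem pinnedTupleWtPowSum_klTowerIncr_subTadpole_le {β : ℝ} (hβ : 0 < β) (U μ : ℝ) (K : TrigPolyC4v) (Dw : ℕ) {d k J' : ℕ} (hd : 1 ≤ d) (hk : 1 ≤ k) (hJ' : d * k ≤ J')
    (hZ : hubbardEffPartitionFnCT L M β U μ 0 K (klScale klE0 (d * k)) ≠ 0)
    {κ : ℝ} (hκ : 0 < κ)
    (hGB : IsGramBoundedR ((sectorSubMatrix L M β (bgmFatMultiplier L M klE0 β (nambuXiCT L μ K) (d * k - 1))).transpose *
      hubbardCovSliceCT L M β μ 0 K (klScale klE0 (d * (k + 1))) (klScale klE0 (d * k)) *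
        sectorSubMatrix L M β (bgmFatMultiplier L M klE0 β (nambuXiCT L μ K) (d * k - 1))) κ)
    (B : ℕ → ℕ → ℝ) (hB0 : ∀ m' Fc, 0 ≤ B m' Fc)
    (hB : ∀ (m' Fc : ℕ) (E : Finset (Fin (2 * m' + 1 + 1))) (τ : Fin (2 * m' + 1 + 1) → SectorLeg (sectorCount (d * k - 1)))
      (q : Fin (2 * m' + 1 + 1)), q ∈ E → E.card = Fc + 1 → ∀ y : SpaceTimeIdx L M,
        imagTimeWeight β M ^ (2 * m' + 1) *
          ∑ σ ∈ univ.filter (fun σ : Fin (2 * m' + 1 + 1) → SectorLeg (sectorCount (d * k - 1)) => ∀ e ∈ E, σ e = τ e),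
            ∑ x ∈ univ.filter (fun x : Fin (2 * m' + 1 + 1) → SpaceTimeIdx L M => x q = y),
              klScaleWtPow L M β J' Dw ((univ.image fun i => (x i, σ i)).image (latticeLegPos (2 * (2 * M)))) *
                ‖sectorisedKernel L M β (klAnisoFamily L M β μ K klE0 (d * k - 1)) (klTowerInput L M β U μ K d k) (2 * m' + 1 + 1) σ x‖ ≤
          B (m' + 1) Fc)
    {α : ℝ} (hα : 0 < α)
    (hrow : ∀ X, ∑ Y, ‖((sectorSubMatrix L M β (bgmFatMultiplier L M klE0 β (nambuXiCT L μ K) (d * k - 1))).transpose *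
        hubbardCovSliceCT L M β μ 0 K (klScale klE0 (d * (k + 1))) (klScale klE0 (d * k)) *
          sectorSubMatrix L M β (bgmFatMultiplier L M klE0 β (nambuXiCT L μ K) (d * k - 1))) X Y‖ *
        klScaleWtPow L M β J' Dw {latticeLegPos (2 * (2 * M)) X, latticeLegPos (2 * (2 * M)) Y} ≤ α)
    (hcol : ∀ Y, ∑ X, ‖((sectorSubMatrix L M β (bgmFatMultiplier L M klE0 β (nambuXiCT L μ K) (d * k - 1))).transpose *
        hubbardCovSliceCT L M β μ 0 K (klScale klE0 (d * (k + 1))) (klScale klE0 (d * k)) *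
          sectorSubMatrix L M β (bgmFatMultiplier L M klE0 β (nambuXiCT L μ K) (d * k - 1))) X Y‖ *
        klScaleWtPow L M β J' Dw {latticeLegPos (2 * (2 * M)) X, latticeLegPos (2 * (2 * M)) Y} ≤ α)
    {ρ : ℝ} (hρ : 0 < ρ)
    (hθ : Real.exp 1 * α * normV (SpaceTimeIdx L M × SectorLeg (sectorCount (d * k - 1))) κ ρ
      (fun m' => (27 : ℝ) ^ 0 * (imagTimeWeight β M * B m' 0)) / κ ^ 2 < 1)
    {cr cc : ℝ} (hcc0 : 0 ≤ cc)
    (hrow' : ∀ X'', ∑ X', ‖(sectorAnalysisMatrix L M β (klAnisoFamily L M β μ K klE0 J') *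
        sectorSubMatrix L M β (bgmFatMultiplier L M klE0 β (nambuXiCT L μ K) (d * k - 1))) X'' X'‖ *
        klScaleWtPow L M β J' Dw {latticeLegPos (2 * (2 * M)) X'', latticeLegPos (2 * (2 * M)) X'} ≤ cr)
    (hcol' : ∀ X', ∑ X'', ‖(sectorAnalysisMatrix L M β (klAnisoFamily L M β μ K klE0 J') *
        sectorSubMatrix L M β (bgmFatMultiplier L M klE0 β (nambuXiCT L μ K) (d * k - 1))) X'' X'‖ *
        klScaleWtPow L M β J' Dw {latticeLegPos (2 * (2 * M)) X'', latticeLegPos (2 * (2 * M)) X'} ≤ cc)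
    {N₀ : ℕ} (hN₀ : 2 ≤ N₀) (q : ℕ) (i : Fin (2 * q + 1 + 1)) (σ' : Fin (2 * q + 1 + 1) → SectorLeg (sectorCount J'))
    (y : SpaceTimeIdx L M) :
    imagTimeWeight β M ^ (2 * q + 1) *
        ∑ x' ∈ univ.filter (fun x' : Fin (2 * q + 1 + 1) → SpaceTimeIdx L M => x' i = y),
          klScaleWtPow L M β J' Dw ((univ.image x').image (fun x : SpaceTimeIdx L M => (((((2 * (x.1 : ℕ) : ℕ)) : ZMod (2 * (2 * M)))), x.2))) *
            ‖sectorisedKernel L M β (klAnisoFamily L M β μ K klE0 J')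
              (klTowerIncr L M β U μ K d k - grassmannLaplacian ℂ (hubbardCovSliceCT L M β μ 0 K (klScale klE0 (d * (k + 1))) (klScale klE0 (d * k))) (klTowerInput L M β U μ K d k))
              (2 * q + 1 + 1) σ' x'‖ ≤
      imagTimeWeight β M ^ (2 * q + 1) *
        (cr * cc ^ (2 * q + 1) *
          (∑ n ∈ Ico 2 N₀, (κ⁻¹ ^ (2 * q + 1 + 1) * κ⁻¹ ^ (2 * (n - 1)) * (α ^ (n - 1) * Real.exp n)) *
              ∑ δ ∈ (Fintype.piFinset fun _ : Fin n => range (Fintype.card (SpaceTimeIdx L M × SectorLeg (sectorCount (d * k - 1))) / 2 + 1)) with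
                  2 * q + 1 + 1 + 2 * (n - 1) ≤ ∑ a, 2 * δ a,
                ∑ pf : ↥(univ.erase i) → Fin n,
                  ((∏ j, ((2 * δ (pf j) : ℕ) : ℝ)) / ((∑ a, 2 * δ a : ℕ) : ℝ) ^ (univ.erase i).card) *
                    ∏ a, (Real.exp 3 * κ) ^ (2 * δ a) *
                      ((27 : ℝ) ^ (univ.filter fun j : ↥(univ.erase i) => pf j = a).card *
                        (imagTimeWeight β M * B (δ a) (univ.filter fun j : ↥(univ.erase i) => pf j = a).card)) +
            ρ⁻¹ ^ (2 * q + 1 + 1) * (Real.exp 1 * normV (SpaceTimeIdx L M × SectorLeg (sectorCount (d * k - 1))) κ ρ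
                (fun m' => (27 : ℝ) ^ 0 * (imagTimeWeight β M * B m' 0))) *
              (Real.exp 1 * α * normV (SpaceTimeIdx L M × SectorLeg (sectorCount (d * k - 1))) κ ρ
                  (fun m' => (27 : ℝ) ^ 0 * (imagTimeWeight β M * B m' 0)) / κ ^ 2) ^ (N₀ - 1) /
              (1 - Real.exp 1 * α * normV (SpaceTimeIdx L M × SectorLeg (sectorCount (d * k - 1))) κ ρ
                  (fun m' => (27 : ℝ) ^ 0 * (imagTimeWeight β M * B m' 0)) / κ ^ 2)) +
          cr * cc ^ (2 * q + 1) *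
            ∑ m' ∈ range (Fintype.card (SpaceTimeIdx L M × SectorLeg (sectorCount (d * k - 1))) / 2 + 1), (if q + 1 + 1 < m' then
              ((((2 * (q + 1)).factorial : ℝ))⁻¹ *
                  ((∏ j ∈ univ.filter (fun j : Fin (2 * (q + 1)) => j ∉ univ.erase i), (2 * m' - (j : ℕ)) : ℕ) : ℝ)) *
                ((2 * m' : ℕ) : ℝ) ^ (univ.erase i).card * κ ^ (2 * m' - 2 * (q + 1)) *
                  ((27 : ℝ) ^ (univ.erase i).card * (imagTimeWeight β M * B m' (univ.erase i).card)) else 0)) := by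
  have hβ' : β ≠ 0 := hβ.ne'
  have hJ₁ : 1 ≤ d * k := le_trans hd (Nat.le_mul_of_pos_right d hk)
  have hJ : d * k ≤ d * (k + 1) := Nat.mul_le_mul_left d (Nat.le_succ k)
  have hwt := isTreeWeight_klScaleWtPow L M hβ.le J' Dw
  have hG : klTowerInput L M β U μ K d k ∈ evenPart ℂ (HubbardFieldIdx L M) := klEffectiveAction_mem_evenPart hβ' U μ K klE0 (d * k)
  have hG0 : constPart ℂ (klTowerInput L M β U μ K d k) = 0 := constPart_klEffectiveAction_eq_zero β U μ K klE0 (d * k) hZ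
  have hε : 0 ≤ imagTimeWeight β M := imagTimeWeight_nonneg hβ.le M
  have hi : i ∉ (univ.erase i : Finset (Fin (2 * q + 1 + 1))) := fun h => (mem_erase.1 h).1 rfl
  -- the two doors at the block geometry, output legs `univ.erase i` prescribed to `σ′`, pin `(y, σ′ i)`
  have h2 := blockStep_ordersGe2_wtFull_le (L := L) (M := M) hwt hβ μ K hJ₁ hJ hJ' (latticeLegPos (2 * (2 * M))) (latticeLegPos (2 * (2 * M)))
    (klTowerInput L M β U μ K d k) hG hG0 hκ hGB B hB0 hB hα hrow hcol hρ hθ hcc0 hrow' hcol' hN₀ i (univ.erase i) hi σ' (y, σ' i)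
  have h1 := blockStep_geTwoLines_wtFull_le (L := L) (M := M) hwt hβ μ K hJ₁ hJ hJ' (latticeLegPos (2 * (2 * M))) (latticeLegPos (2 * (2 * M)))
    (klTowerInput L M β U μ K d k) hG hκ.le hGB B hB0 hB hcc0 hrow' hcol' i (univ.erase i) hi σ' (y, σ' i)
  -- relabel both door outputs to the carrier's single-tuple form
  rw [sum_filter_prescribedAll_eq_pinnedTuplePow] at h2 h1
  -- split the increment
  refine mul_le_mul_of_nonneg_left ?_ (pow_nonneg hε _)
  rw [show klTowerIncr L M β U μ K d k - grassmannLaplacian ℂ (hubbardCovSliceCT L M β μ 0 K (klScale klE0 (d * (k + 1))) (klScale klE0 (d * k))) (klTowerInput L M β U μ K d k) =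
      (effAction ℂ (hubbardCovSliceCT L M β μ 0 K (klScale klE0 (d * (k + 1))) (klScale klE0 (d * k))) (klTowerInput L M β U μ K d k) -
          gaussConv ℂ (hubbardCovSliceCT L M β μ 0 K (klScale klE0 (d * (k + 1))) (klScale klE0 (d * k))) (klTowerInput L M β U μ K d k)) +
        (gaussConv ℂ (hubbardCovSliceCT L M β μ 0 K (klScale klE0 (d * (k + 1))) (klScale klE0 (d * k))) (klTowerInput L M β U μ K d k) -
          klTowerInput L M β U μ K d k -
          grassmannLaplacian ℂ (hubbardCovSliceCT L M β μ 0 K (klScale klE0 (d * (k + 1))) (klScale klE0 (d * k))) (klTowerInput L M β U μ K d k)) from by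
    rw [klTowerIncr_eq_ordersGe2_add_firstOrder β U μ K d k hZ]; abel]
  refine le_trans (sum_le_sum fun x' _ => ?_) (le_trans (le_of_eq (sum_add_distrib (s := univ.filter
    (fun x' : Fin (2 * q + 1 + 1) → SpaceTimeIdx L M => x' i = y)))) (add_le_add h2 h1))
  rw [← mul_add, sectorisedKernel_add, Pi.add_apply, Pi.add_apply]
  exact mul_le_mul_of_nonneg_left (norm_add_le _ _) (zero_le_one.trans (one_le_klScaleWtPow L M β J' Dw _))


/-! ## §2 The pin-free right side at the born family -/

/-- **THE SAME AT THE BORN FAMILY `J′ = dk`, PIN-FREE RIGHT SIDE** (landing profiles over `Fin (2q+1)`, first-order falling factor `(2m′ − i) ≤ 2m′`); no carrier is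
introduced. [cite: BenfattoGiulianiMastropietro2006, (2.70)-(2.71a), (2.86)-(2.90), (3.5)-(3.6)] -/
theorem pinnedTupleWtPowSum_klTowerIncr_subTadpole_le_pinFree {β : ℝ} (hβ : 0 < β) (U μ : ℝ) (K : TrigPolyC4v) (Dw : ℕ) {d k : ℕ} (hd : 1 ≤ d) (hk : 1 ≤ k)
    (hZ : hubbardEffPartitionFnCT L M β U μ 0 K (klScale klE0 (d * k)) ≠ 0)
    {κ : ℝ} (hκ : 0 < κ)
    (hGB : IsGramBoundedR ((sectorSubMatrix L M β (bgmFatMultiplier L M klE0 β (nambuXiCT L μ K) (d * k - 1))).transpose *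
      hubbardCovSliceCT L M β μ 0 K (klScale klE0 (d * (k + 1))) (klScale klE0 (d * k)) *
        sectorSubMatrix L M β (bgmFatMultiplier L M klE0 β (nambuXiCT L μ K) (d * k - 1))) κ)
    (B : ℕ → ℕ → ℝ) (hB0 : ∀ m' Fc, 0 ≤ B m' Fc)
    (hB : ∀ (m' Fc : ℕ) (E : Finset (Fin (2 * m' + 1 + 1))) (τ : Fin (2 * m' + 1 + 1) → SectorLeg (sectorCount (d * k - 1)))
      (q : Fin (2 * m' + 1 + 1)), q ∈ E → E.card = Fc + 1 → ∀ y : SpaceTimeIdx L M,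
        imagTimeWeight β M ^ (2 * m' + 1) *
          ∑ σ ∈ univ.filter (fun σ : Fin (2 * m' + 1 + 1) → SectorLeg (sectorCount (d * k - 1)) => ∀ e ∈ E, σ e = τ e),
            ∑ x ∈ univ.filter (fun x : Fin (2 * m' + 1 + 1) → SpaceTimeIdx L M => x q = y),
              klScaleWtPow L M β (d * k) Dw ((univ.image fun i => (x i, σ i)).image (latticeLegPos (2 * (2 * M)))) *
                ‖sectorisedKernel L M β (klAnisoFamily L M β μ K klE0 (d * k - 1)) (klTowerInput L M β U μ K d k) (2 * m' + 1 + 1) σ x‖ ≤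
          B (m' + 1) Fc)
    {α : ℝ} (hα : 0 < α)
    (hrow : ∀ X, ∑ Y, ‖((sectorSubMatrix L M β (bgmFatMultiplier L M klE0 β (nambuXiCT L μ K) (d * k - 1))).transpose *
        hubbardCovSliceCT L M β μ 0 K (klScale klE0 (d * (k + 1))) (klScale klE0 (d * k)) *
          sectorSubMatrix L M β (bgmFatMultiplier L M klE0 β (nambuXiCT L μ K) (d * k - 1))) X Y‖ *
        klScaleWtPow L M β (d * k) Dw {latticeLegPos (2 * (2 * M)) X, latticeLegPos (2 * (2 * M)) Y} ≤ α)
    (hcol : ∀ Y, ∑ X, ‖((sectorSubMatrix L M β (bgmFatMultiplier L M klE0 β (nambuXiCT L μ K) (d * k - 1))).transpose *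
        hubbardCovSliceCT L M β μ 0 K (klScale klE0 (d * (k + 1))) (klScale klE0 (d * k)) *
          sectorSubMatrix L M β (bgmFatMultiplier L M klE0 β (nambuXiCT L μ K) (d * k - 1))) X Y‖ *
        klScaleWtPow L M β (d * k) Dw {latticeLegPos (2 * (2 * M)) X, latticeLegPos (2 * (2 * M)) Y} ≤ α)
    {ρ : ℝ} (hρ : 0 < ρ)
    (hθ : Real.exp 1 * α * normV (SpaceTimeIdx L M × SectorLeg (sectorCount (d * k - 1))) κ ρ
      (fun m' => (27 : ℝ) ^ 0 * (imagTimeWeight β M * B m' 0)) / κ ^ 2 < 1)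
    {cr cc : ℝ} (hcr0 : 0 ≤ cr) (hcc0 : 0 ≤ cc)
    (hrow' : ∀ X'', ∑ X', ‖(sectorAnalysisMatrix L M β (klAnisoFamily L M β μ K klE0 (d * k)) *
        sectorSubMatrix L M β (bgmFatMultiplier L M klE0 β (nambuXiCT L μ K) (d * k - 1))) X'' X'‖ *
        klScaleWtPow L M β (d * k) Dw {latticeLegPos (2 * (2 * M)) X'', latticeLegPos (2 * (2 * M)) X'} ≤ cr)
    (hcol' : ∀ X', ∑ X'', ‖(sectorAnalysisMatrix L M β (klAnisoFamily L M β μ K klE0 (d * k)) *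
        sectorSubMatrix L M β (bgmFatMultiplier L M klE0 β (nambuXiCT L μ K) (d * k - 1))) X'' X'‖ *
        klScaleWtPow L M β (d * k) Dw {latticeLegPos (2 * (2 * M)) X'', latticeLegPos (2 * (2 * M)) X'} ≤ cc)
    {N₀ : ℕ} (hN₀ : 2 ≤ N₀) (q : ℕ) (i : Fin (2 * q + 1 + 1)) (σ' : Fin (2 * q + 1 + 1) → SectorLeg (sectorCount (d * k)))
    (y : SpaceTimeIdx L M) :
    imagTimeWeight β M ^ (2 * q + 1) *
        ∑ x' ∈ univ.filter (fun x' : Fin (2 * q + 1 + 1) → SpaceTimeIdx L M => x' i = y),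
          klScaleWtPow L M β (d * k) Dw ((univ.image x').image (fun x : SpaceTimeIdx L M => (((((2 * (x.1 : ℕ) : ℕ)) : ZMod (2 * (2 * M)))), x.2))) *
            ‖sectorisedKernel L M β (klAnisoFamily L M β μ K klE0 (d * k))
              (klTowerIncr L M β U μ K d k - grassmannLaplacian ℂ (hubbardCovSliceCT L M β μ 0 K (klScale klE0 (d * (k + 1))) (klScale klE0 (d * k))) (klTowerInput L M β U μ K d k))
              (2 * q + 1 + 1) σ' x'‖ ≤
      imagTimeWeight β M ^ (2 * q + 1) *
        (cr * cc ^ (2 * q + 1) *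
          (∑ n ∈ Ico 2 N₀, (κ⁻¹ ^ (2 * q + 1 + 1) * κ⁻¹ ^ (2 * (n - 1)) * (α ^ (n - 1) * Real.exp n)) *
              ∑ δ ∈ (Fintype.piFinset fun _ : Fin n => range (Fintype.card (SpaceTimeIdx L M × SectorLeg (sectorCount (d * k - 1))) / 2 + 1)) with
                  2 * q + 1 + 1 + 2 * (n - 1) ≤ ∑ a, 2 * δ a,
                ∑ pf : Fin (2 * q + 1) → Fin n,
                  ((∏ j, ((2 * δ (pf j) : ℕ) : ℝ)) / ((∑ a, 2 * δ a : ℕ) : ℝ) ^ (2 * q + 1)) *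
                    ∏ a, (Real.exp 3 * κ) ^ (2 * δ a) *
                      ((27 : ℝ) ^ (univ.filter fun j : Fin (2 * q + 1) => pf j = a).card *
                        (imagTimeWeight β M * B (δ a) (univ.filter fun j : Fin (2 * q + 1) => pf j = a).card)) +
            ρ⁻¹ ^ (2 * q + 1 + 1) * (Real.exp 1 * normV (SpaceTimeIdx L M × SectorLeg (sectorCount (d * k - 1))) κ ρ
                (fun m' => (27 : ℝ) ^ 0 * (imagTimeWeight β M * B m' 0))) *
              (Real.exp 1 * α * normV (SpaceTimeIdx L M × SectorLeg (sectorCount (d * k - 1))) κ ρ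
                  (fun m' => (27 : ℝ) ^ 0 * (imagTimeWeight β M * B m' 0)) / κ ^ 2) ^ (N₀ - 1) /
              (1 - Real.exp 1 * α * normV (SpaceTimeIdx L M × SectorLeg (sectorCount (d * k - 1))) κ ρ
                  (fun m' => (27 : ℝ) ^ 0 * (imagTimeWeight β M * B m' 0)) / κ ^ 2)) +
          cr * cc ^ (2 * q + 1) *
            ∑ m' ∈ range (Fintype.card (SpaceTimeIdx L M × SectorLeg (sectorCount (d * k - 1))) / 2 + 1), (if q + 1 + 1 < m' then
              (((2 * (q + 1)).factorial : ℝ))⁻¹ * ((2 * m' : ℕ) : ℝ) ^ (2 * (q + 1)) * κ ^ (2 * m' - 2 * (q + 1)) *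
                ((27 : ℝ) ^ (2 * q + 1) * (imagTimeWeight β M * B m' (2 * q + 1))) else 0)) := by
  have hε : 0 ≤ imagTimeWeight β M := imagTimeWeight_nonneg hβ.le M
  have hmain := pinnedTupleWtPowSum_klTowerIncr_subTadpole_le (L := L) (M := M) hβ U μ K Dw hd hk le_rfl hZ hκ hGB B hB0 hB hα hrow hcol hρ hθ hcc0 hrow' hcol'
    hN₀ q i σ' y
  refine hmain.trans (mul_le_mul_of_nonneg_left (add_le_add (mul_le_mul_of_nonneg_left (add_le_add
    (le_of_eq (sum_congr rfl fun n _ => congrArg _ (sum_congr rfl fun δ _ => ?_))) le_rfl) (by positivity))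
    (mul_le_mul_of_nonneg_left (sum_le_sum fun m' _ => ?_) (by positivity))) (pow_nonneg hε _))
  · -- landing profiles over `univ.erase i` ↦ over `Fin (2q+1)`
    have hcard : (univ.erase i : Finset (Fin (2 * q + 1 + 1))).card = 2 * q + 1 := by
      rw [card_erase_of_mem (mem_univ _), card_univ, Fintype.card_fin]; rfl
    have hcardT : Fintype.card (univ.erase i : Finset (Fin (2 * q + 1 + 1))) = 2 * q + 1 := by
      rw [Fintype.card_coe, hcard]
    obtain ⟨e⟩ : Nonempty (Fin (2 * q + 1) ≃ (univ.erase i : Finset (Fin (2 * q + 1 + 1)))) :=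
      ⟨(Fintype.equivFinOfCardEq hcardT).symm⟩
    have h := sum_landingProfiles_eq_of_equiv e (fun l => ((2 * δ l : ℕ) : ℝ)) ((∑ a, 2 * δ a : ℕ) : ℝ)
      (fun a c => (Real.exp 3 * κ) ^ (2 * δ a) * ((27 : ℝ) ^ c * (imagTimeWeight β M * B (δ a) c)))
    rw [hcardT, Fintype.card_fin] at h
    rw [hcard]
    exact h
  · -- the first-order summand: `(2m′ − i) ≤ 2m′`, `|univ.erase i| = 2q+1`
    have hcard : (univ.erase i : Finset (Fin (2 * q + 1 + 1))).card = 2 * q + 1 := by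
      rw [card_erase_of_mem (mem_univ _), card_univ, Fintype.card_fin]; rfl
    split_ifs with hq
    · rw [hcard]
      have hfilt : (univ.filter fun j : Fin (2 * (q + 1)) => j ∉ (univ.erase i : Finset (Fin (2 * q + 1 + 1)))) = {i} := by
        ext j
        simp only [mem_filter, mem_univ, true_and, mem_erase, ne_eq, not_and, not_true_eq_false, imp_false, not_not,
          mem_singleton]
      rw [hfilt, prod_singleton]
      have hle : (((2 * m' - (i : ℕ) : ℕ)) : ℝ) ≤ ((2 * m' : ℕ) : ℝ) := by exact_mod_cast Nat.sub_le _ _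
      have h27 : 0 ≤ (27 : ℝ) ^ (2 * q + 1) * (imagTimeWeight β M * B m' (2 * q + 1)) := by
        have := hB0 m' (2 * q + 1); positivity
      calc (((2 * (q + 1)).factorial : ℝ))⁻¹ * (((2 * m' - (i : ℕ) : ℕ)) : ℝ) * ((2 * m' : ℕ) : ℝ) ^ (2 * q + 1) *
              κ ^ (2 * m' - 2 * (q + 1)) * ((27 : ℝ) ^ (2 * q + 1) * (imagTimeWeight β M * B m' (2 * q + 1)))
          ≤ (((2 * (q + 1)).factorial : ℝ))⁻¹ * ((2 * m' : ℕ) : ℝ) * ((2 * m' : ℕ) : ℝ) ^ (2 * q + 1) *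
              κ ^ (2 * m' - 2 * (q + 1)) * ((27 : ℝ) ^ (2 * q + 1) * (imagTimeWeight β M * B m' (2 * q + 1))) := by
            gcongr
        _ = (((2 * (q + 1)).factorial : ℝ))⁻¹ * ((2 * m' : ℕ) : ℝ) ^ (2 * (q + 1)) * κ ^ (2 * m' - 2 * (q + 1)) *
              ((27 : ℝ) ^ (2 * q + 1) * (imagTimeWeight β M * B m' (2 * q + 1))) := by ring
    · exact le_rfl

end Born

end Summit.HubbardSuperconductivity.HubbardSuperconductivity.Theorems.EngineV8

end
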